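import Literature.Barriers.CriticalPhenomena.PlaquetteWalkHoleRootLateralCellLaw
import Literature.Barriers.CriticalPhenomena.PlaquetteWalkWoundMassBound
import Literature.Barriers.CriticalPhenomena.PlaquetteWalkRootPlaquetteDefectLaw
import HarnessLib

/-!
# Barrier catalogue (SAWScalingLimit): the wound-mass bound is an EQUALITY OF MODULI term by term; at the far and
lateral cells of a hole root it splits into the two route masses

Companion of `PlaquetteWalkWoundMassBound` (`‖VF_D(a, f₀)‖ ≤ v(θ)·Σ woundMassAt` at every plaquette),
`PlaquetteWalkRootPlaquetteDefectLaw` (Lemma E `norm_backBracket`: every backward half-bracket has modulus `v(θ)`),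
`PlaquetteWalkHoleRootFarCellLaw` (Part A's sign law `ΩG.classTerm_dichotomy` at an arbitrary plaquette; the FAR-CELL
LAW) and `PlaquetteWalkHoleRootLateralCellLaw` (the LATERAL-CELL LAW). Riders that need several of them:

* ★ `ΩG.norm_classTerm_eq_of_wound` — every WOUND class-`B2a` group, at any plaquette and for any root, is a vector of
  length EXACTLY `v(θ)·extWeight`: the wound-mass bound is attained term by term, so all cancellation in the vertex
  functional is cancellation of DIRECTIONS;
* `ΩG.woundMassAt_farCell_eq` / `ΩG.woundMassAt_latN_eq` — at the far / lateral cell the wound mass is the sum of the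
  two route masses ((R1));
* ★ `PlaquetteWalk.norm_vertexFunctional_printed_farCellW_eq` / `…_latN_eq` — `‖VF(far)‖ = v(θ)·|M_N − M_S|`,
  `‖VF(latN)‖ = v(θ)·|M_W − M_E|`: the general bound `v·(M₁ + M₂)` is attained there iff one route is empty.

[cite: GlazmanManolescu2019, Lemma 2.1 (statement, "in the form given in [Gl]")] [cite: Glazman2015WeightedSAW, Lemma 3.1 (proof, pp. 6–7)]
Written for the venture lane «pcv-sawmu» (Tier B, b-step0 gen 18).
-/

noncomputable section

namespace Literature.Probability.RandomPlanarGeometry.SAW.YangBaxter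

open Real Complex

namespace ΩG

variable {D : Set Face} {a : MidEdge} {r : Face}

/-- ★ **Every WOUND excursion group is a vector of length exactly `v(θ)·extWeight`**, at any plaquette, for any root
(sign law ⊕ `|phase| = 1` ⊕ Lemma E). [cite: GlazmanManolescu2019, Lemma 2.1 (statement, "in the form given in [Gl]")]
[cite: Glazman2015WeightedSAW, Lemma 3.1 (proof, pp. 6–7)] -/
theorem norm_classTerm_eq_of_wound {θ : ℝ} (hθ : θ ∈ Set.Icc (π / 3) (2 * π / 3)) (ω : ΩG D a r)
    (hr : RootedFace D a r) (h : ω.IsB2a)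
    (hW : ω.WE (fun _ => θ) ≠ excursionWinding θ ω.2.firstSideG (ω.z1 hr h) ω.1) :
    ‖ω.classTerm (fun _ => θ) hr‖ = weightV θ * ω.2.extWeight (fun _ => θ) r := by
  rcases ω.classTerm_dichotomy hr h θ with ⟨hWE, _⟩ | ⟨_, hct⟩
  · exact absurd hWE hW
  · obtain ⟨hz01, hz02, hz12⟩ := ω.firstSide_exit_return_distinct hr h
    have h3 := ω.z₃_spec hr h
    have hext : 0 ≤ ω.2.extWeight (fun _ => θ) r := Finset.prod_nonneg fun _ _ => localWeight_nonneg hθ _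
    have hsgn : ‖((chordSign ω.2.firstSideG (ω.z1 hr h) ω.1 : ℤ) : ℂ)‖ = 1 := by
      rcases chordSign_eq_or ω.2.firstSideG (ω.z1 hr h) ω.1 with e | e <;> rw [e] <;> simp
    rw [hct, norm_mul, norm_mul, norm_mul, Complex.norm_real, Real.norm_eq_abs, abs_of_nonneg hext, phase,
      Complex.norm_exp_ofReal_mul_I, hsgn,
      norm_backBracket hθ (σ := ω.2.firstSideG) (z₁ := ω.z1 hr h) (z₂ := ω.1) (z₃ := ω.z₃ hr h) hz01 hz02
        (fun e => h3.1 e.symm) hz12 (fun e => h3.2.1 e.symm) (fun e => h3.2.2 e.symm)]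
    ring

/-- The wound mass of a wound class-`B2a` walk is its exterior weight, and its group has exactly that length times `v`.
[cite: GlazmanManolescu2019, Lemma 2.1 (statement, "in the form given in [Gl]")] -/
theorem norm_classTerm_eq_weightV_mul_woundMassAt {θ : ℝ} (hθ : θ ∈ Set.Icc (π / 3) (2 * π / 3)) (ω : ΩG D a r)
    (hr : RootedFace D a r) : ‖ω.classTerm (fun _ => θ) hr‖ = weightV θ * woundMassAt θ hr ω := by
  unfold woundMassAt
  by_cases h : ω.IsB2a
  · rw [dif_pos h]
    by_cases hW : ω.WE (fun _ => θ) ≠ excursionWinding θ ω.2.firstSideG (ω.z1 hr h) ω.1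
    · rw [if_pos hW, ω.norm_classTerm_eq_of_wound hθ hr h hW]
    · rw [if_neg hW, mul_zero]
      rcases ω.classTerm_dichotomy hr h θ with ⟨_, h0⟩ | ⟨hWE, _⟩
      · rw [h0, norm_zero]
      · exact absurd hWE hW
  · rw [dif_neg h, mul_zero]
    unfold classTerm
    rw [dif_neg h, norm_zero]

end ΩG

namespace ΩG

variable {D : Set Face} {w : Face}

/-- At the far cell the wound mass is the sum of the two route masses (a wound walk enters from `N` or `S`).
[cite: GlazmanManolescu2019, Lemma 2.1 (proof: [Gl])] [cite: Glazman2015WeightedSAW, Lemma 3.1 (proof, pp. 6–7)] -/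
theorem woundMassAt_farCell_eq (hh : holeFaceW w ∉ D) (θ : ℝ) (hr : RootedFace D (w.side .W) (farW w))
    (ω : ΩG D (w.side .W) (farW w)) :
    woundMassAt θ hr ω = routeMassW θ hr .N ω + routeMassW θ hr .S ω := by
  unfold woundMassAt routeMassW
  by_cases h : ω.IsB2a
  · simp only [dif_pos h]
    by_cases hW : ω.WE (fun _ => θ) ≠ excursionWinding θ ω.2.firstSideG (ω.z1 hr h) ω.1
    · rw [if_pos hW]
      rcases firstSide_eq_N_or_S_of_WE_ne hh ω hr h hW with e | e
      · rw [if_pos ⟨e, hW⟩, if_neg (fun H => by rw [e] at H; exact absurd H.1 (by decide)), add_zero]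
      · rw [if_neg (fun H => by rw [e] at H; exact absurd H.1 (by decide)), if_pos ⟨e, hW⟩, zero_add]
    · rw [if_neg hW, if_neg (fun H => hW H.2), if_neg (fun H => hW H.2), add_zero]
  · simp only [dif_neg h, add_zero]

/-- At the lateral cell the wound mass is the sum of the two route masses (a wound walk enters from `E` or `W`).
[cite: GlazmanManolescu2019, Lemma 2.1 (proof: [Gl])] [cite: Glazman2015WeightedSAW, Lemma 3.1 (proof, pp. 6–7)] -/
theorem woundMassAt_latN_eq (hh : holeFaceW w ∉ D) (θ : ℝ) (hr : RootedFace D (w.side .W) (latN w))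
    (ω : ΩG D (w.side .W) (latN w)) :
    woundMassAt θ hr ω = routeMassL θ hr .E ω + routeMassL θ hr .W ω := by
  unfold woundMassAt routeMassL
  by_cases h : ω.IsB2a
  · simp only [dif_pos h]
    by_cases hW : ω.WE (fun _ => θ) ≠ excursionWinding θ ω.2.firstSideG (ω.z1 hr h) ω.1
    · rw [if_pos hW]
      rcases firstSide_eq_E_or_W_of_WE_ne hh ω hr h hW with e | e
      · rw [if_pos ⟨e, hW⟩, if_neg (fun H => by rw [e] at H; exact absurd H.1 (by decide)), add_zero]
      · rw [if_neg (fun H => by rw [e] at H; exact absurd H.1 (by decide)), if_pos ⟨e, hW⟩, zero_add]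
    · rw [if_neg hW, if_neg (fun H => hW H.2), if_neg (fun H => hW H.2), add_zero]
  · simp only [dif_neg h, add_zero]

end ΩG

end Literature.Probability.RandomPlanarGeometry.SAW.YangBaxter

namespace Literature.Barriers.CriticalPhenomena.PlaquetteWalk

open Literature.Probability.RandomPlanarGeometry.SAW.YangBaxter
open Real Complex

/-- ★ **The modulus of the far-cell defect is EXACTLY `v(θ)·|M_N − M_S|`** (≤ `v·(M_N + M_S)` = `v`·wound mass, with
equality iff one route is empty). [cite: GlazmanManolescu2019, Lemma 2.1 (statement, "in the form given in [Gl]")] [cite: Glazman2015WeightedSAW, Lemma 3.1, eq. (1) (the weight v(θ))] -/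
theorem norm_vertexFunctional_printed_farCellW_eq {θ : ℝ} (hθ : θ ∈ Set.Icc (π / 3) (2 * π / 3))
    (Dl : List Face) (w : Face) (hf : farW w ∈ Dl) (hh : holeFaceW w ∉ dom Dl)
    (hr : RootedFace (dom Dl) (w.side .W) (farW w)) :
    ‖vertexFunctional (printedWeights θ) tFiveEighths (ybCoeff θ) Dl (w.side .W) (farW w)‖ =
      weightV θ * |(∑ ω ∈ ΩG.setB2a (dom Dl) (w.side .W) (farW w), ΩG.routeMassW θ hr .N ω) -
        ∑ ω ∈ ΩG.setB2a (dom Dl) (w.side .W) (farW w), ΩG.routeMassW θ hr .S ω| := by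
  rw [vertexFunctional_printed_farCellW_eq hθ Dl w hf hh hr, norm_mul, norm_mul, Complex.norm_I, one_mul,
    Complex.norm_real, Complex.norm_real, Real.norm_eq_abs, Real.norm_eq_abs, abs_of_nonneg (weightV_nonneg hθ)]

/-- ★ **The modulus of the lateral defect is EXACTLY `v(θ)·|M_W − M_E|`.**
[cite: GlazmanManolescu2019, Lemma 2.1 (statement, "in the form given in [Gl]")] [cite: Glazman2015WeightedSAW, Lemma 3.1, eq. (1) (the weight v(θ))] -/
theorem norm_vertexFunctional_printed_latN_eq {θ : ℝ} (hθ : θ ∈ Set.Icc (π / 3) (2 * π / 3))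
    (Dl : List Face) (w : Face) (hf : latN w ∈ Dl) (hh : holeFaceW w ∉ dom Dl)
    (hr : RootedFace (dom Dl) (w.side .W) (latN w)) :
    ‖vertexFunctional (printedWeights θ) tFiveEighths (ybCoeff θ) Dl (w.side .W) (latN w)‖ =
      weightV θ * |(∑ ω ∈ ΩG.setB2a (dom Dl) (w.side .W) (latN w), ΩG.routeMassL θ hr .W ω) -
        ∑ ω ∈ ΩG.setB2a (dom Dl) (w.side .W) (latN w), ΩG.routeMassL θ hr .E ω| := by
  rw [vertexFunctional_printed_latN_eq hθ Dl w hf hh hr, norm_mul, norm_mul, norm_mul, Complex.norm_I, one_mul,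
    norm_latDir, mul_one, Complex.norm_real, Complex.norm_real, Real.norm_eq_abs, Real.norm_eq_abs,
    abs_of_nonneg (weightV_nonneg hθ)]

end Literature.Barriers.CriticalPhenomena.PlaquetteWalk
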